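import Summits.BirchSwinnertonDyer.BirchSwinnertonDyer.Theorems.QuadraticBranchSignedControlPlusKatoDivisibilityIotaOfNamedFactsContra
import Literature.NumberTheory.EllipticCurves.Kato2004.ConditionVOfNotHasCMProofs
import HarnessLib

/-!
# K8, Kato side PRINT-EXACT on the tree's duals, ALL NON-CM Gss2 ROWS: (RK⁺)^ι
# `pⁿ · Char X⁺(V/ℚ_∞)·(ι L_p⁺(V,η,X)) ⊆ Char X⁺(V/F_∞)` (`n = 0` when `ρ̄_{V,p^m}` is onto) from `{hZ′ (p608027), Q73′ (p600084), h12}`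
# — the row hypothesis (v) for `V^{(p*)}` displayed, then discharged by the open-image theorem for non-CM `V`

Cell `bsd-potss` (HOME `run/shared/lean/pub/bsd-potss/`), seat `bsd-potss-k8q-c2x` g10 (prover; lane B of the K8 Kato side,
route `QuadraticBranchSignedControl`), duty T-Q73ι-2 «K8-IOTA» (planner g27). HONEST FRAMING: THEOREMS ONLY — no definition, no named
fact, no instance, no `sorry`; closes no item; the named-fact inputs are displayed as hypotheses — `hZc` =
`Kobayashi2003.thm62_63_73_etaColemanPoitouTate_zeta_contra`, `h134c` = `Kato2004.thm13_4_lengthAt_fineSelmerDualContra_le_of_isEulerSystemClass`,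
`h12` = `Kobayashi2003.thm12_signedSelmerDual_finite_torsion`; nothing of Kato/Kobayashi is proved here; BSD is proved for no curve.

## What and why

The landed ι-form row theorem (`…PlusKatoDivisibilityIotaOfNamedFactsContra`, p612326) serves the TOWER-ONTO rows (crux
`PlusKatoDivisibilityBranchOntoIotaOfNamedInputs`), deriving Kato's hypothesis (v) for the twist `V^{(p*)}` from tower surjectivity.
Kobayashi's Thm. 4.1 FIRST display (the `pⁿ` form) holds in print for EVERY curve; on the Kato-13.4 road it needs (v), which the
tree PROVES for every non-CM curve (Serre's open image, `Kato2004.exists_finrank_coker_eq_one_quadraticTwist_primeStar_of_not_hasCM`,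
seat k8q-c2x g5) and which FAILS for CM curves (g6). THIS FILE records the ι-honest reading on that exact reach — the print-exact twin
of g6's `KatoSideNonCM.quadraticBranchPlusKatoDivisibilityAt_of_facts_of_not_hasCM` (p563694, inputs print∘ι):

* §1 `quadraticBranchPlusKatoDivisibilityIota_row_…_of_conditionV` — the row theorem with (v) for `V^{(p*)}` DISPLAYED (no surjectivity
  assumed): the body of `Additive.QuadraticBranchPlusKatoDivisibilityIotaAt V p` for one curve.
* §2 `quadraticBranchPlusKatoDivisibilityIotaAt_…_of_not_hasCM` and the by-name ∀-row form
  **`plusKatoDivisibilityBranchIota_nonCM_ofNamedFactsContra : hZ′ → Q73′ → h12 → ∀ V p, 5 ≤ p → good → a_p = 0 → ¬CM →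
  Additive.QuadraticBranchPlusKatoDivisibilityIotaAt V p`** — the ι-honest twin of the aside `PlusKatoDivisibilityBranch` (item 21377)
  on the non-CM rows; the CM rows are NOT claimed (there (v) fails; printed road = Kato Thm. 12.5 via §15 / Rubin).
* §3 the `η`-level non-CM corollaries `etaKatoDivisibility[Contra|Invol]_nonCM_…` of part 2 (p611198) — the inputs a print-exact re-key of
  the NON-onto η-item's Kato half would consume (not ordered today; recorded because they are five lines each).

References: [Kobayashi2003] Thm. 1.2 (p. 2), Thm. 2.2 (p. 5), Thm. 4.1 (p. 8), last sentence of §7 (p. 13); [Kato2004Asterisque] Thm. 13.4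
and the remark on (v) (p. 226), (12.5.2) (p. 222); [Serre1972] (open image; via the tree's `…of_not_hasCM`); [GreenbergLNM1716] §3.
-/

noncomputable section

-- justification: the `Summit.BirchSwinnertonDyer.BirchSwinnertonDyer.…` path repeats a component (route-file convention)
set_option linter.dupNamespace false
set_option autoImplicit false

open scoped Classical

namespace Summit.BirchSwinnertonDyer.BirchSwinnertonDyer.Theorems

namespace KatoSideIotaContra

open CongruenceSubgroup Field WeierstrassCurve
open Literature.NumberTheory.EllipticCurves
open Literature.NumberTheory.EllipticCurves.ModularForms
open Literature.NumberTheory.EllipticCurves.Module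
open Literature.NumberTheory.GaloisRepresentations
open Summit.BirchSwinnertonDyer.Rank1Residual.Additive hiding EtaSignedSelmerDualData
open Summit.BirchSwinnertonDyer.Rank1Residual.Additive.SignedTwist
open Summit.BirchSwinnertonDyer.BirchSwinnertonDyer.Theses.QuadraticBranchSignedControl
open SignedKatoOffTwo.IwasawaInvolution

section RowV

variable {p : ℕ} [Fact p.Prime]

/-! ## §1 (RK⁺)^ι for ONE curve under the ROW hypothesis (v) for `V^{(p*)}` (displayed) -/

/-- **(RK⁺)^ι — the body of `Additive.QuadraticBranchPlusKatoDivisibilityIotaAt V p` — for ONE curve from `{hZ′, Q73′, h12}` + the PROVED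
descent frame, under Kato's ROW hypothesis (v) for the twist `V^{(p*)}` DISPLAYED as `hv`** (no surjectivity assumed): for every
admissible `ℚ(√p*)`-model, `X⁺(V/F_∞)` is finitely generated `Λ`-torsion and `pⁿ · Char X⁺(V/ℚ_∞)·(ι Lη) ⊆ Char X⁺(V/F_∞)`, with `n = 0`
if `ρ̄_{V,p^m}` is onto for all `m`. Same road as the onto-row theorem of `…IotaOfNamedFactsContra` (decomposition over
`etaDescentFrame_proof`, `h12`, the ι-form η-statement of part 2 at `hv`, multiplicativity of `Char`).
[cite: Kobayashi2003, Thm. 1.2 (p. 2), Thm. 2.2 (p. 5), Thm. 4.1 (p. 8)] [cite: Kato2004Asterisque, Thm. 13.4 (2)(3)(v) (p. 226), (12.5.2) (p. 222)]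
[cite: GreenbergLNM1716, §3 (descent; reading)] -/
theorem quadraticBranchPlusKatoDivisibilityIota_row_of_zetaContra_of_thm13_4Contra_of_thm12_of_conditionV
    (hZc : Kobayashi2003.thm62_63_73_etaColemanPoitouTate_zeta_contra)
    (h134c : Kato2004.thm13_4_lengthAt_fineSelmerDualContra_le_of_isEulerSystemClass)
    (h12 : Kobayashi2003.thm12_signedSelmerDual_finite_torsion)
    (V : WeierstrassCurve ℚ) [V.IsElliptic] [V.IsGloballyMinimal] (hp5 : 5 ≤ p)
    (hgood : V.HasGoodReductionAtPrime p) (hap : V.frobeniusTrace p = 0)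
    (hv : ∀ [(V.quadraticTwist (((-1 : ℚ) ^ (p / 2)) * p)).IsElliptic],
      ∃ σ : absoluteGaloisGroup ℚ,
        (∀ (n : ℕ) (t : AlgebraicClosure ℚ), t ^ p ^ n = 1 → σ • t = t) ∧
          Module.finrank ℤ_[p]
            (((V.quadraticTwist (((-1 : ℚ) ^ (p / 2)) * p)).tateModule p) ⧸
              LinearMap.range
                ((V.quadraticTwist (((-1 : ℚ) ^ (p / 2)) * p)).galoisRepTate p σ - 1)) = 1)
    (F : Type) [Field F] [NumberField F] (V' : WeierstrassCurve F) [V'.IsElliptic]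
    {κ : ZpExtension ℚ p} {γ : Field.absoluteGaloisGroup ℚ}
    {κF : ZpExtension F p} {γF : Field.absoluteGaloisGroup F}
    {N : ℕ} [NeZero N] {f : CuspForm (Gamma0 N) 2}
    (hF : Module.finrank ℚ F = 2) (hθ : ∃ θ : F, θ ^ 2 = algebraMap ℚ F ((-1) ^ (p / 2) * p))
    (hC : ∃ C : VariableChange F, C • V.baseChange F = V')
    (hκ : κ.IsCyclotomic) (hγ : κ.IsTopGenerator γ) (hγc : IsCyclotomicVariable p γ)
    (hκF : κF.IsCyclotomic) (hγF : κF.IsTopGenerator γF)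
    (hζ : ∃ ζ : ℤ_[p]ˣ, IsOfFinOrder ζ ∧
      ((GaloisRep.cyclotomicCharacter F p γF * ζ : ℤ_[p]ˣ) : ℤ_[p]) =
        (cyclotomicGenerator p : ℤ_[p]))
    (hf : IsNewformOf V f) (ϖ : ℚ)
    (hϖ : if Even (p / 2) then (ϖ : ℝ) * V.realPeriodRat = plusPeriod f
        else (ϖ : ℝ) * V.imaginaryPeriodRat = minusPeriod f)
    (Lη : IwasawaAlgebra p)
    (hL : Summit.BirchSwinnertonDyer.Rank1Residual.Additive.IsQuadraticBranchPlusLFunction f p ϖ Lη)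
    (D : Kobayashi2003.SignedSelmerDualData V κ γ 1) (DF : Kobayashi2003.SignedSelmerDualData V' κF γF 1) :
    Module.Finite (IwasawaAlgebra p) DF.X ∧ Module.IsTorsion (IwasawaAlgebra p) DF.X ∧
      (∃ n : ℕ, Ideal.span {(p : IwasawaAlgebra p) ^ n} *
          (D.charIdeal * Ideal.span {IwasawaAlgebra.invol p Lη}) ≤ DF.charIdeal) ∧
      ((∀ m : ℕ, V.HasSurjectiveModNGaloisRep (p ^ m : ℕ)) →
        D.charIdeal * Ideal.span {IwasawaAlgebra.invol p Lη} ≤ DF.charIdeal) := by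
  have hp2 : p ≠ 2 := by omega
  haveI : NeZero p := ⟨(Fact.out : p.Prime).ne_zero⟩
  haveI : IsCyclotomicExtension {p} ℚ (CyclotomicField p ℚ) :=
    CyclotomicField.isCyclotomicExtension p ℚ
  haveI : (galRange (K := ℚ) (CyclotomicField p ℚ)).Normal := normal_galRange_cyclotomic p _
  obtain ⟨θ, ηq, -, -, -, hηK, hη1⟩ := exists_theta_eta_cyclotomicField p hp2
  obtain ⟨γ', hγ'K, hγ', hγ'c, Dη, ⟨e⟩⟩ :=
    exists_etaDatum_prod_linearEquiv_of_decomposition (CyclotomicField p ℚ) ηq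
      (fun κ₁ γ₁ hκ₁ hγ₁ hγ₁K hγ₁c F₁ _ _ V₁ _ κF₁ γF₁ hF₁ hθ₁ hC₁ hκF₁ hγF₁ hζ₁ =>
        etaDescentFrame_proof p hp5 (CyclotomicField p ℚ) ηq hηK hη1 V hgood hap κ₁ γ₁ hκ₁ hγ₁ hγ₁K
          hγ₁c F₁ V₁ κF₁ γF₁ hF₁ hθ₁ hC₁ hκF₁ hγF₁ hζ₁)
      F V' hF hθ hC hκ hγ hγc hκF hγF hζ D DF
  obtain ⟨hDfin, hDtor⟩ := h12 V p hp2 hgood hap κ γ hκ hγ 1 D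
  -- Thm. 2.2 and Thm. 4.1 at `η` for `Dη` in `ι`-form (§5), through the Literature promotion copy of the `η`-object
  let Dη' : Kobayashi2003.EtaSignedSelmerDualData V κ (CyclotomicField p ℚ) ℚ_[p] ηq γ' 1 :=
    { X := Dη.X
      conj_mem := Dη.conj_mem
      toDual := Dη.toDual
      bijective := Dη.bijective
      toDual_T_smul := Dη.toDual_T_smul
      toDual_C_smul := Dη.toDual_C_smul }
  obtain ⟨hηfin, hηtor, ⟨n, hn⟩, hint⟩ :=
    etaKatoDivisibilityInvol_of_zetaContra_of_thm13_4Contra hZc h134c (CyclotomicField p ℚ) ηq hηK hη1 V hv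
      hp2 hgood hap hf ϖ hϖ Lη hL κ γ' hκ hγ' hγ'K hγ'c Dη'
  haveI : Module.Finite (IwasawaAlgebra p) D.X := hDfin
  haveI : Module.Finite (IwasawaAlgebra p) Dη.X := hηfin
  have hPtor : Module.IsTorsion (IwasawaAlgebra p) (D.X × Dη.X) :=
    isTorsion_prod_of_isTorsion hDtor hηtor
  have hPchar : Module.charIdeal (IwasawaAlgebra p) (D.X × Dη.X) =
      Module.charIdeal (IwasawaAlgebra p) D.X * Module.charIdeal (IwasawaAlgebra p) Dη.X :=
    charIdeal_mul_of_shortExact_holds p (D.X × Dη.X) hPtor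
      (LinearMap.inl (IwasawaAlgebra p) D.X Dη.X) (LinearMap.snd (IwasawaAlgebra p) D.X Dη.X)
      LinearMap.inl_injective LinearMap.snd_surjective .inl_snd
  have htorF : Module.IsTorsion (IwasawaAlgebra p) DF.X := by
    intro x
    obtain ⟨a, ha⟩ := @hPtor (e x)
    refine ⟨a, ?_⟩
    rw [Submonoid.smul_def] at ha ⊢
    have h := congrArg e.symm ha
    rwa [map_smul, map_zero, LinearEquiv.symm_apply_apply] at h
  have hcharF : DF.charIdeal = D.charIdeal * Dη.charIdeal := by
    change Module.charIdeal (IwasawaAlgebra p) DF.X =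
      Module.charIdeal (IwasawaAlgebra p) D.X * Module.charIdeal (IwasawaAlgebra p) Dη.X
    rw [Module.charIdeal_eq_of_linearEquiv e]
    exact hPchar
  refine ⟨Module.Finite.equiv e.symm, htorF, ⟨n, ?_⟩, fun hsurj' => ?_⟩
  · rw [hcharF, mul_left_comm, Ideal.span_singleton_mul_span_singleton]
    exact Ideal.mul_mono_right ((Ideal.span_singleton_le_iff_mem _).mpr hn)
  · rw [hcharF]
    exact Ideal.mul_mono_right ((Ideal.span_singleton_le_iff_mem _).mpr (hint hsurj'))

end RowV

/-! ## §2 The non-CM rows: (v) for `V^{(p*)}` discharged by the open-image theorem -/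

section NonCM

variable {p : ℕ} [Fact p.Prime]

/-- **(RK⁺)^ι `Additive.QuadraticBranchPlusKatoDivisibilityIotaAt V p` for EVERY non-CM Gss2 curve**, onto or not: for `V/ℚ` globally
minimal WITHOUT complex multiplication, `p ≥ 5` good with `a_p(V) = 0`, granted `hZ′`, `Q73′`, `h12` — §1 with its row hypothesis (v)
for `V^{(p*)}` DISCHARGED by `Kato2004.exists_finrank_coker_eq_one_quadraticTwist_primeStar_of_not_hasCM` (Serre's open image; seat g5).
Print-exact on the tree's duals; CONDITIONAL on the three named facts; closes nothing. The ι-honest twin of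
`KatoSideNonCM.quadraticBranchPlusKatoDivisibilityAt_of_facts_of_not_hasCM` (p563694).
[cite: Kobayashi2003, Thm. 4.1 (p. 8), first display] [cite: Kato2004Asterisque, Thm. 13.4 and the remark on (v) (p. 226)] -/
theorem quadraticBranchPlusKatoDivisibilityIotaAt_of_zetaContra_of_thm13_4Contra_of_thm12_of_not_hasCM
    (hZc : Kobayashi2003.thm62_63_73_etaColemanPoitouTate_zeta_contra)
    (h134c : Kato2004.thm13_4_lengthAt_fineSelmerDualContra_le_of_isEulerSystemClass)
    (h12 : Kobayashi2003.thm12_signedSelmerDual_finite_torsion)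
    (V : WeierstrassCurve ℚ) [V.IsElliptic] [V.IsGloballyMinimal] (hp5 : 5 ≤ p)
    (hgood : V.HasGoodReductionAtPrime p) (hap : V.frobeniusTrace p = 0) (hV : ¬ V.HasCM) :
    Summit.BirchSwinnertonDyer.Rank1Residual.Additive.QuadraticBranchPlusKatoDivisibilityIotaAt V p := by
  intro F _ _ V' _ κ γ κF γF N _ f _ _ _ hF hθ hC hκ hγ hγc hκF hγF hζ hf ϖ hϖ Lη hL D DF
  exact quadraticBranchPlusKatoDivisibilityIota_row_of_zetaContra_of_thm13_4Contra_of_thm12_of_conditionV hZc h134c h12 V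
    hp5 hgood hap (Kato2004.exists_finrank_coker_eq_one_quadraticTwist_primeStar_of_not_hasCM (by omega) V hV) F V' hF hθ
    hC hκ hγ hγc hκF hγF hζ hf ϖ hϖ Lη hL D DF

/-- **The aside decl `PlusKatoDivisibilityBranch` (item 21377) IN ITS ι-HONEST FORM, restricted to the NON-CM rows, BY NAME from the three
print-exact facts**: `hZ′ → Q73′ → h12 → ∀ V p, 5 ≤ p → good → a_p = 0 → ¬CM → Additive.QuadraticBranchPlusKatoDivisibilityIotaAt V p`.
The CM rows are NOT claimed (there Kato's (v) fails: `Kato2004.exists_finrank_coker_eq_one_iff_not_hasCM`). CONDITIONAL; closes nothing.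
[cite: Kato2004Asterisque, Thm. 13.4 and the remark on (v) (p. 226)] [cite: Kobayashi2003, Thm. 4.1 (p. 8)] -/
theorem plusKatoDivisibilityBranchIota_nonCM_ofNamedFactsContra
    (hZc : Kobayashi2003.thm62_63_73_etaColemanPoitouTate_zeta_contra)
    (h134c : Kato2004.thm13_4_lengthAt_fineSelmerDualContra_le_of_isEulerSystemClass)
    (h12 : Kobayashi2003.thm12_signedSelmerDual_finite_torsion) :
    ∀ (V : WeierstrassCurve ℚ) [V.IsElliptic] [V.IsGloballyMinimal] (p : ℕ) [Fact p.Prime],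
      5 ≤ p → V.HasGoodReductionAtPrime p → V.frobeniusTrace p = 0 → ¬ V.HasCM →
        Summit.BirchSwinnertonDyer.Rank1Residual.Additive.QuadraticBranchPlusKatoDivisibilityIotaAt V p :=
  fun V _ _ _ _ hp5 hgood hap hV =>
    quadraticBranchPlusKatoDivisibilityIotaAt_of_zetaContra_of_thm13_4Contra_of_thm12_of_not_hasCM hZc h134c h12 V hp5
      hgood hap hV

end NonCM

/-! ## §3 The η-level statements on the non-CM rows (part 2 at the open-image (v)) -/

section EtaNonCM

variable {p : ℕ} [Fact p.Prime]

/-- **Kobayashi Thm. 2.2 (`+`) / Thm. 4.1 at `η` for a CONTRAGREDIENT η-datum of a NON-CM curve from `{hZ′, Q73′}`** — part 2's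
`etaKatoDivisibilityContra_of_zetaContra_of_thm13_4Contra` with (v) for `V^{(p*)}` discharged by the open-image theorem: `X(D)` f.g.
torsion, `pⁿ Lη ∈ Char X(D)`, `Lη ∈ Char X(D)` on onto rows. Print-exact, ι-free. [cite: Kobayashi2003, Thm. 2.2 (p. 5), Thm. 4.1 (p. 8)]
[cite: Kato2004Asterisque, Thm. 13.4 and the remark on (v) (p. 226)] -/
theorem etaKatoDivisibilityContra_nonCM_of_zetaContra_of_thm13_4Contra
    (hZc : Kobayashi2003.thm62_63_73_etaColemanPoitouTate_zeta_contra)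
    (h134c : Kato2004.thm13_4_lengthAt_fineSelmerDualContra_le_of_isEulerSystemClass)
    (K₀ : Type) [Field K₀] [NumberField K₀] [IsCyclotomicExtension {p} ℚ K₀]
    [(galRange (K := ℚ) K₀).Normal] (ηq : absoluteGaloisGroup ℚ →* ℤˣ)
    (hηK : ∀ σ ∈ galRange (K := ℚ) K₀, ηq σ = 1) (hη1 : ηq ≠ 1)
    (V : WeierstrassCurve ℚ) [V.IsElliptic] [V.IsGloballyMinimal] (hV : ¬ V.HasCM)
    {N : ℕ} [NeZero N] {f : CuspForm (Gamma0 N) 2} (hp2 : p ≠ 2)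
    (hgood : V.HasGoodReductionAtPrime p) (hap : V.frobeniusTrace p = 0) (hf : IsNewformOf V f)
    (ϖ : ℚ) (hϖ : if Even (p / 2) then (ϖ : ℝ) * V.realPeriodRat = plusPeriod f
      else (ϖ : ℝ) * V.imaginaryPeriodRat = minusPeriod f)
    (Lη : IwasawaAlgebra p)
    (hL : Summit.BirchSwinnertonDyer.Rank1Residual.Additive.IsQuadraticBranchPlusLFunction f p ϖ Lη)
    (κ : ZpExtension ℚ p) (γ : absoluteGaloisGroup ℚ) (hκ : κ.IsCyclotomic) (hγ : κ.IsTopGenerator γ)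
    (hγK : γ ∈ galRange (K := ℚ) K₀) (hγc : IsCyclotomicVariable p γ)
    (D : Kobayashi2003.EtaSignedSelmerDualData V κ K₀ ℚ_[p] ηq γ⁻¹ 1) :
    Module.Finite (IwasawaAlgebra p) D.X ∧ Module.IsTorsion (IwasawaAlgebra p) D.X ∧
      (∃ n : ℕ, (p : IwasawaAlgebra p) ^ n * Lη ∈ D.charIdeal) ∧
      ((∀ m : ℕ, V.HasSurjectiveModNGaloisRep (p ^ m : ℕ)) → Lη ∈ D.charIdeal) :=
  etaKatoDivisibilityContra_of_zetaContra_of_thm13_4Contra hZc h134c K₀ ηq hηK hη1 V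
    (Kato2004.exists_finrank_coker_eq_one_quadraticTwist_primeStar_of_not_hasCM hp2 V hV) hp2 hgood hap hf ϖ hϖ Lη hL κ
    γ hκ hγ hγK hγc D

/-- **The same read on the TREE-convention η-datum `D` over `γ` of a NON-CM curve**: `X(D)` f.g. torsion, `pⁿ·ι Lη ∈ Char X(D)`,
`ι Lη ∈ Char X(D)` on onto rows — part 2's `etaKatoDivisibilityInvol_…` at the open-image (v). No functional equation, no symmetry
hypothesis. [cite: Kobayashi2003, Thm. 2.2 (p. 5), Thm. 4.1 (p. 8), Def. 2.1 (p. 5)] [cite: Kato2004Asterisque, Thm. 13.4 (v) (p. 226)] -/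
theorem etaKatoDivisibilityInvol_nonCM_of_zetaContra_of_thm13_4Contra
    (hZc : Kobayashi2003.thm62_63_73_etaColemanPoitouTate_zeta_contra)
    (h134c : Kato2004.thm13_4_lengthAt_fineSelmerDualContra_le_of_isEulerSystemClass)
    (K₀ : Type) [Field K₀] [NumberField K₀] [IsCyclotomicExtension {p} ℚ K₀]
    [(galRange (K := ℚ) K₀).Normal] (ηq : absoluteGaloisGroup ℚ →* ℤˣ)
    (hηK : ∀ σ ∈ galRange (K := ℚ) K₀, ηq σ = 1) (hη1 : ηq ≠ 1)
    (V : WeierstrassCurve ℚ) [V.IsElliptic] [V.IsGloballyMinimal] (hV : ¬ V.HasCM)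
    {N : ℕ} [NeZero N] {f : CuspForm (Gamma0 N) 2} (hp2 : p ≠ 2)
    (hgood : V.HasGoodReductionAtPrime p) (hap : V.frobeniusTrace p = 0) (hf : IsNewformOf V f)
    (ϖ : ℚ) (hϖ : if Even (p / 2) then (ϖ : ℝ) * V.realPeriodRat = plusPeriod f
      else (ϖ : ℝ) * V.imaginaryPeriodRat = minusPeriod f)
    (Lη : IwasawaAlgebra p)
    (hL : Summit.BirchSwinnertonDyer.Rank1Residual.Additive.IsQuadraticBranchPlusLFunction f p ϖ Lη)
    (κ : ZpExtension ℚ p) (γ : absoluteGaloisGroup ℚ) (hκ : κ.IsCyclotomic) (hγ : κ.IsTopGenerator γ)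
    (hγK : γ ∈ galRange (K := ℚ) K₀) (hγc : IsCyclotomicVariable p γ)
    (D : Kobayashi2003.EtaSignedSelmerDualData V κ K₀ ℚ_[p] ηq γ 1) :
    Module.Finite (IwasawaAlgebra p) D.X ∧ Module.IsTorsion (IwasawaAlgebra p) D.X ∧
      (∃ n : ℕ, (p : IwasawaAlgebra p) ^ n * IwasawaAlgebra.invol p Lη ∈ D.charIdeal) ∧
      ((∀ m : ℕ, V.HasSurjectiveModNGaloisRep (p ^ m : ℕ)) → IwasawaAlgebra.invol p Lη ∈ D.charIdeal) :=
  etaKatoDivisibilityInvol_of_zetaContra_of_thm13_4Contra hZc h134c K₀ ηq hηK hη1 V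
    (Kato2004.exists_finrank_coker_eq_one_quadraticTwist_primeStar_of_not_hasCM hp2 V hV) hp2 hgood hap hf ϖ hϖ Lη hL κ
    γ hκ hγ hγK hγc D

end EtaNonCM

end KatoSideIotaContra

end Summit.BirchSwinnertonDyer.BirchSwinnertonDyer.Theorems

end
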